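import Literature.MathematicalPhysics.QuantumFieldTheory.Balaban1983to89.B9Delta2Def134
import Literature.MathematicalPhysics.QuantumFieldTheory.Balaban1983to89.B9Eq336CurrentBound
import Literature.MathematicalPhysics.QuantumFieldTheory.Balaban1983to89.B9SectDSup

/-!
# `Balaban1983to89.B9Ineq3137Regular` — B9 p. 422, the first bound of (3.137), «|(H*J)(b)| ≦ O(1)Mα₀(Lʲη)⁻³ for b ∈ Λ_j»,
# with its (3.36)-input and its [4] Lemma 2.1 scale sum DISCHARGED: p10's `B9Delta2Def134.ineq3137a_of_3133_336` composed
# with the current bound of `B9Eq336CurrentBound` (regularity conditions (3.35)–(3.36)) and the (2.60)/(2.61) tools of the tree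

HONEST FRAMING (cell `lit-balaban`, verbatim): statement-level skeleton of published theorems with citation tags; proofs
where landed; nothing here is a claim about the Yang–Mills mass gap.

DOCFIX (cell `lit-balaban`, seat r06 gen 15, 2026-08-22; p37 `CITELOC-SWEEP-B4B9.md` §2b page-numeral slips, text layer re-read): (3.137) is p. 423 [PDF 35] ((3.136) p. 422; p. 422 ends «The inequality (149) in [5] implies») — the locators of (3.137) in this file corrected accordingly (9 place(s)); declarations, statements and proofs byte-identical to the tree copy of record (p249367).

CITATION HEADER (lean-in-tree rule).  T. Bałaban, *Propagators for lattice gauge theories in a background field*, Commun.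
Math. Phys. **99** (1985) 389–434 [`Balaban1985BackgroundPropagators`] (cell paper B9; journal page = PDF page + 388),
p. 422 [PDF 34] (the sentence before (3.137)), p. 396 [PDF 8] (3.35)–(3.36), p. 392 [PDF 4] (3.11); the scale sum is
[4] = T. Bałaban, *Propagators and renormalization transformations for lattice gauge theories. II*, Commun. Math. Phys. **96**
(1984) 223–250 [`Balaban1984PropagatorsII`], Lemma 2.1 (2.60)–(2.61) p. 234 with the scale-transfer remark of B9 p. 398.
Cell `lit-balaban` seat r06 gen 5 (B9 fold owner), SKELETON row `B9.Eq3.134` (the (3.137) member, first bound) with row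
`B9.Eq3.35`; text read from the held text layer `paper:balaban1985-cmp99-background-propagators` p. 34 and the page render
`b2b-balaban-ref1/pages/1985-cmp99-background-propagators/…-p034-x2.png`.

WHAT IS PRINTED.  p. 422: *"To find bounds for the operator Δ⁽²⁾ let us write it in the form Δ⁽²⁾A = Σ_{j=1}^{k} Σ_{b∈Λ_j}
(Lʲη)^{d+1} tr (δ/δA)C_j⁽²⁾(A,b)(H\*J)(b). (3.136) From the regularity condition (3.36) and the inequality (3.133) we have the
estimate |(H\*J)(b)| ≦ O(1)Mα₀(Lʲη)⁻³ for b ∈ Λ_j."* — the first of the two bounds that p10's `B9Delta2Def134` types as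
`Ineq3137a` / `Ineq3137b` ((3.137) p. 423).  p. 396 (3.35)–(3.36): on every big cube the background is a small field in some
gauge, `U^u = e^{iηA}`, `|A| < O(1)Mα₀(Lʲη)⁻¹`, `|∇^ηA| < O(1)Mα₀(Lʲη)⁻²`, `|∂^{η*}∂^ηA| < O(1)Mα₀(Lʲη)⁻³`.

WHAT THIS FILE PROVES (one definition with body, theorems; no `Prop` placeholders, 0 new facts).
p10's `B9Delta2Def134.ineq3137a_of_3133_336` derives `Ineq3137a` from three hypotheses of printed shape: `h3133` = (3.133)
summed over the blocks Δ(y) in the adjoint `(H*J)(b) = Σ_x η^d H(x,b)ᵀJ(x)` (`|(H*J)(y₀)| ≦ C_H Σ_y (L^{j_y}η)^d(L^{j₀}η)^{−d}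
e^{−½δ₁d(y,y₀)}·sup_{Δ(y)}|J|`), `h336` = «(3.36) through (3.11)» (`sup_{Δ(y)}|J| ≦ c_J Mα₀(L^{j_y}η)⁻³`), and `h21` = the
scale sum of [4] Lemma 2.1 (`Σ_y (L^{j_y}η)^{d−3}e^{−½δ₁d(y,y₀)} ≦ c₁(L^{j₀}η)^{d−3}`).  Here:
* §1 `bsupOn blk y F = sup_{b ∈ Δ(y)} |F(b)|`, the block supremum of a bond function over the cube `Δ(y) = blk⁻¹(y)` of the
  localization (the «sup_{Δ(y)}|J|» of `h3133`), with `norm_le_bsupOn` / `bsupOn_le` / `bsupOn_nonneg`.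
* §2 **`bsupOn_J_le_of_regular`**: for the current `J = D*η⁻²Im ∂U` of (3.11) (`B9Eq39Adjoint.J`, pv27 vocabulary: abstract
  finite lattice, commuting shifts, complete normed ℂ-algebra) and a background regular in the sense of (3.35)–(3.36) at every
  bond at the scale of its block (`B9Eq336CurrentBound.RegularAt`, constant `C = O(1)Mα₀ ≦ 1`), `sup_{Δ(y)}|J| ≦ 10⁴d·C·(L^{j_y}η)⁻³`
  — the `h336` shape, from r06 g4's `norm_J_le_blocks`.
* §3 **`scaleSum_le`**: the `h21` shape at a general rate `ρ ≧ σ + 2αδ₀` with `c₁ = L^{d+3}·c`, from the tree's typed (2.60)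
  (`B6RandomWalk.Ineq260`, through `B9SectDL2Decay.len_pow_le_of_ineq260` / `inv_len_pow_le_of_ineq260`) and the row sum at rate σ
  (`B11SectG.RowSum`), under `max(d,3)·log L ≦ αδ₀RM` and the symmetry of d.
* §4 **`ineq3137a_of_3133_regular`** (general `C`) and **`ineq3137a_printed_of_regular`** (`C = Mα₀`, conclusion literally p10's
  `Ineq3137a g HJ (C_H·10⁴d·L^{d+3}c) M α₀`): (3.137), first bound, with `h336` and `h21` DISCHARGED — the only remaining
  printed-shape input is `h3133` ((3.133) = Theorem 3.3-type bounds for `H`, a statement row of the skeleton).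
Companion of r06 g4's `B9Ineq3131Regular` (the same discharge for (3.131)).

NOT CLAIMED: (3.133), Theorem 3.12, the second bound of (3.137) (its input is the (149)-display of [5], `B9Delta2Def134.ineq3137b_of_149`);
the covering geometry «on □» beyond the abstract site sets of `RegularAt` (cf. `B9Eq336CurrentBound` SCOPE (ii)).
-/

noncomputable section

open NormedSpace Complex

namespace Literature.MathematicalPhysics.QuantumFieldTheory.Balaban1983to89.B9Ineq3137Regular

open Literature.MathematicalPhysics.QuantumFieldTheory.Balaban1983to89
open Literature.MathematicalPhysics.QuantumFieldTheory.Balaban1983to89.B9Eq39Adjoint (J)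
open Literature.MathematicalPhysics.QuantumFieldTheory.Balaban1983to89.B6RandomWalk (Ineq260)
open Literature.MathematicalPhysics.QuantumFieldTheory.Balaban1983to89.B11SectG (RowSum)
open Literature.MathematicalPhysics.QuantumFieldTheory.Balaban1983to89.B9SectDSup (DistSymm)
open Literature.MathematicalPhysics.QuantumFieldTheory.Balaban1983to89.B9Eq336CurrentBound (RegularAt norm_J_le_blocks)
open Literature.MathematicalPhysics.QuantumFieldTheory.Balaban1983to89.B9Delta2Def134 (Ineq3137a ineq3137a_of_3133_336)

/-! ## §1 The block supremum `sup_{Δ(y)} |F|` of a bond function -/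

section BlockSup

variable {𝔸 : Type*} [NormedRing 𝔸] {S : Type*} {ι : Type*} {Y : Type*} (blk : S → Y)

/-- `sup_{b ∈ Δ(y)} |F(b)|` — the supremum of (the norms of) a bond function `F_μ(x)` over the bonds based in ONE cube
`Δ(y) = blk⁻¹(y)` of the localization (p. 397: *"if y ∈ Λ_j, then Δ(y) = B^j(y)"*); the «sup_{Δ(y)}|J|» entering the block-summed
form of (3.133) in the first bound of (3.137).  (`0` for an empty cube.) [cite: Balaban1985BackgroundPropagators, (3.137) p.423; (3.39) p.397] -/
def bsupOn (y : Y) (F : ι → S → 𝔸) : ℝ := ⨆ b : {b : ι × S // blk b.2 = y}, ‖F b.1.1 b.1.2‖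

/-- `bsupOn` unfolded. [cite: Balaban1985BackgroundPropagators, (3.137) p.423] -/
theorem bsupOn_def (y : Y) (F : ι → S → 𝔸) :
    bsupOn blk y F = ⨆ b : {b : ι × S // blk b.2 = y}, ‖F b.1.1 b.1.2‖ := rfl

/-- `|F(b)| ≦ sup_{Δ(y)}|F|` for a bond `b = (x, x + ηe_μ)` based in `Δ(y)` (finite lattice). [cite: Balaban1985BackgroundPropagators, (3.137) p.423] -/
theorem norm_le_bsupOn [Finite S] [Finite ι] (F : ι → S → 𝔸) {y : Y} {x : S} (μ : ι) (hx : blk x = y) :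
    ‖F μ x‖ ≤ bsupOn blk y F :=
  le_ciSup (f := fun b : {b : ι × S // blk b.2 = y} => ‖F b.1.1 b.1.2‖) (Set.finite_range _).bddAbove ⟨(μ, x), hx⟩

/-- `0 ≦ sup_{Δ(y)}|F|`. [cite: Balaban1985BackgroundPropagators, (3.137) p.423] -/
theorem bsupOn_nonneg (y : Y) (F : ι → S → 𝔸) : 0 ≤ bsupOn blk y F := Real.iSup_nonneg fun _ => norm_nonneg _

/-- A uniform bound on the bonds of `Δ(y)` bounds `sup_{Δ(y)}|F|`. [cite: Balaban1985BackgroundPropagators, (3.137) p.423] -/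
theorem bsupOn_le {y : Y} {F : ι → S → 𝔸} {c : ℝ} (hc : 0 ≤ c) (h : ∀ μ x, blk x = y → ‖F μ x‖ ≤ c) :
    bsupOn blk y F ≤ c :=
  Real.iSup_le (fun b => h b.1.1 b.1.2 b.2) hc

end BlockSup

/-! ## §2 (3.35)–(3.36) ⇒ `sup_{Δ(y)}|J| ≦ 10⁴d·C·(L^{j_y}η)⁻³` — the `h336` input -/

section J336

variable {𝔸 : Type*} [NormedRing 𝔸] [NormedAlgebra ℂ 𝔸] [CompleteSpace 𝔸]
variable {S : Type*} {ι : Type*} [Fintype ι] [LinearOrder ι]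
variable (T : ι → Equiv.Perm S) (U : ι → S → 𝔸ˣ) {g : B6.Geometry} (blk : S → g.Site)

/-- **«From the regularity condition (3.36) … »** — the block suprema of the current `J = D*η⁻²Im ∂U` (3.11) for a background
regular in the sense of (3.35)–(3.36) at every bond at the scale `L^{j(b)}η = g.len (blk b)` of its block (`RegularAt`, constant
`C = O(1)Mα₀ ≦ 1`): `sup_{Δ(y)}|J| ≦ 10⁴d·C·(L^{j_y}η)⁻³` — the `h336` hypothesis of `B9Delta2Def134.ineq3137a_of_3133_336` with
`c_J·Mα₀ = 10⁴d·C` (r06 g4 `B9Eq336CurrentBound.norm_J_le_blocks`, bond by bond).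
[cite: Balaban1985BackgroundPropagators, (3.137) p.423, (3.35)–(3.36) p.396, (3.11) p.392] -/
theorem bsupOn_J_le_of_regular (hT : ∀ μ ν x, T μ (T ν x) = T ν (T μ x)) {η C : ℝ} (hη : 0 < η) (hC0 : 0 ≤ C)
    (hC1 : C ≤ 1) (hηlen : ∀ z : g.Site, η ≤ g.len z) (hreg : ∀ μ x, RegularAt T U η C (g.len (blk x)) μ x)
    (y : g.Site) :
    bsupOn blk y (J T U η) ≤ 10 ^ 4 * Fintype.card ι * C * (g.len y)⁻¹ ^ 3 := by
  have hlen : 0 < g.len y := hη.trans_le (hηlen y)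
  refine bsupOn_le blk (mul_nonneg (mul_nonneg (by positivity) hC0) (pow_nonneg (inv_nonneg.2 hlen.le) 3))
    fun μ x hx => ?_
  have h := norm_J_le_blocks T hT hη hC0 hC1 U blk g.len hηlen hreg μ x
  rwa [hx, ← inv_pow] at h

end J336

/-! ## §3 The scale sum of [4] Lemma 2.1 — the `h21` input, from (2.60) and the row sum (2.61) -/

section Lemma21

variable {g : B6.Geometry}

/-- **The Lemma-2.1 scale sum behind the first bound of (3.137)**: `Σ_y (L^{j_y}η)^d (L^{j_y}η)⁻³ e^{−ρd(y,y₀)} ≦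
L^{d+3}·c·(L^{j₀}η)^d(L^{j₀}η)⁻³` — each factor `(L^{j_y}η)^{±t}` is moved to the scale of `y₀` at the cost `Lᵗe^{αδ₀d(y,y₀)}` by
(2.60) (the scale-transfer remark of B9 p. 398; tree: `B9SectDL2Decay.len_pow_le_of_ineq260` / `inv_len_pow_le_of_ineq260`, under
`t·log L ≦ αδ₀RM` for `t = d, 3`), and the remaining `Σ_y e^{−(ρ−2αδ₀)d(y₀,y)}` is the row sum (2.61) at any rate `σ ≦ ρ − 2αδ₀`
(`B11SectG.RowSum g σ c`); d symmetric.  This is the `h21` hypothesis of `B9Delta2Def134.ineq3137a_of_3133_336` (there at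
`ρ = ½δ₁`) with `c₁ = L^{d+3}c`.
[cite: Balaban1985BackgroundPropagators, (3.137) p.423, p.398 (remark after (3.47)); Balaban1984PropagatorsII, Lemma 2.1 (2.60)–(2.61) p.234] -/
theorem scaleSum_le (d : ℕ) (hd : ∀ a b : g.Site, 0 ≤ g.dist a b) (hsym : DistSymm g) {δ₀ α σ c ρ : ℝ}
    (h260 : Ineq260 g δ₀ α) (hαδ : 0 ≤ α * δ₀) (hrow : RowSum g σ c) (hσρ : σ + 2 * (α * δ₀) ≤ ρ)
    (hL : 1 ≤ g.L) (hge : 0 < g.eta) (hRMd : (d : ℝ) * Real.log g.L ≤ α * δ₀ * g.R * g.M)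
    (hRM3 : (3 : ℝ) * Real.log g.L ≤ α * δ₀ * g.R * g.M) (y₀ : g.Site) :
    ∑ y : g.Site, g.len y ^ d * (g.len y)⁻¹ ^ 3 * Real.exp (-ρ * g.dist y y₀) ≤
      g.L ^ (d + 3) * c * (g.len y₀ ^ d * (g.len y₀)⁻¹ ^ 3) := by
  have hL0 : 0 < g.L := lt_of_lt_of_le one_pos hL
  have hlen : ∀ z : g.Site, 0 < g.len z := fun z => mul_pos (pow_pos hL0 _) hge
  have hRM3' : ((3 : ℕ) : ℝ) * Real.log g.L ≤ α * δ₀ * g.R * g.M := by exact_mod_cast hRM3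
  have hK : 0 ≤ g.len y₀ ^ d * (g.len y₀)⁻¹ ^ 3 :=
    mul_nonneg (pow_nonneg (hlen y₀).le d) (pow_nonneg (inv_nonneg.2 (hlen y₀).le) 3)
  -- termwise: both length factors moved to the scale of `y₀`, the exponent absorbed at rate σ
  have hterm : ∀ y : g.Site, g.len y ^ d * (g.len y)⁻¹ ^ 3 * Real.exp (-ρ * g.dist y y₀) ≤
      g.L ^ (d + 3) * (g.len y₀ ^ d * (g.len y₀)⁻¹ ^ 3) * Real.exp (-(σ * g.dist y₀ y)) := by
    intro y
    have h1 := B9SectDL2Decay.len_pow_le_of_ineq260 h260 hαδ hd hL hge.le d hRMd y₀ y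
    have h2 := B9SectDL2Decay.inv_len_pow_le_of_ineq260 h260 hαδ hd hL hge 3 hRM3' y y₀
    rw [hsym y y₀] at h2 ⊢
    set D := g.dist y₀ y with hD
    have hD0 : 0 ≤ D := hd y₀ y
    have h12 : g.len y ^ d * (g.len y)⁻¹ ^ 3 ≤
        (g.L ^ d * g.len y₀ ^ d * Real.exp (α * δ₀ * D)) * (g.L ^ 3 * (g.len y₀ ^ 3)⁻¹ * Real.exp (α * δ₀ * D)) := by
      rw [inv_pow]
      exact mul_le_mul h1 h2 (inv_nonneg.2 (pow_nonneg (hlen y).le 3))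
        (mul_nonneg (mul_nonneg (pow_nonneg hL0.le d) (pow_nonneg (hlen y₀).le d)) (Real.exp_pos _).le)
    have hexp : Real.exp (α * δ₀ * D) * Real.exp (α * δ₀ * D) * Real.exp (-ρ * D) ≤ Real.exp (-(σ * D)) := by
      rw [← Real.exp_add, ← Real.exp_add, Real.exp_le_exp]
      nlinarith [hD0, hσρ]
    calc g.len y ^ d * (g.len y)⁻¹ ^ 3 * Real.exp (-ρ * D)
        ≤ (g.L ^ d * g.len y₀ ^ d * Real.exp (α * δ₀ * D)) * (g.L ^ 3 * (g.len y₀ ^ 3)⁻¹ * Real.exp (α * δ₀ * D))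
            * Real.exp (-ρ * D) := mul_le_mul_of_nonneg_right h12 (Real.exp_pos _).le
      _ = g.L ^ (d + 3) * (g.len y₀ ^ d * (g.len y₀)⁻¹ ^ 3)
            * (Real.exp (α * δ₀ * D) * Real.exp (α * δ₀ * D) * Real.exp (-ρ * D)) := by
          rw [pow_add, inv_pow]; ring
      _ ≤ g.L ^ (d + 3) * (g.len y₀ ^ d * (g.len y₀)⁻¹ ^ 3) * Real.exp (-(σ * D)) :=
          mul_le_mul_of_nonneg_left hexp (mul_nonneg (pow_nonneg hL0.le _) hK)
  calc ∑ y : g.Site, g.len y ^ d * (g.len y)⁻¹ ^ 3 * Real.exp (-ρ * g.dist y y₀)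
      ≤ ∑ y : g.Site, g.L ^ (d + 3) * (g.len y₀ ^ d * (g.len y₀)⁻¹ ^ 3) * Real.exp (-(σ * g.dist y₀ y)) :=
        Finset.sum_le_sum fun y _ => hterm y
    _ = g.L ^ (d + 3) * (g.len y₀ ^ d * (g.len y₀)⁻¹ ^ 3) * ∑ y : g.Site, Real.exp (-(σ * g.dist y₀ y)) := by
        rw [Finset.mul_sum]
    _ ≤ g.L ^ (d + 3) * (g.len y₀ ^ d * (g.len y₀)⁻¹ ^ 3) * c :=
        mul_le_mul_of_nonneg_left (hrow y₀) (mul_nonneg (pow_nonneg hL0.le _) hK)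
    _ = g.L ^ (d + 3) * c * (g.len y₀ ^ d * (g.len y₀)⁻¹ ^ 3) := by ring

end Lemma21

/-! ## §4 (3.137), first bound, for a regular background -/

section Main

variable {𝔸 : Type*} [NormedRing 𝔸] [NormedAlgebra ℂ 𝔸] [CompleteSpace 𝔸]
variable {S : Type*} {ι : Type*} [Fintype ι] [LinearOrder ι]
variable (T : ι → Equiv.Perm S) (U : ι → S → 𝔸ˣ) {g : B6.Geometry} (blk : S → g.Site)

/-- **(3.137), FIRST BOUND, FOR A REGULAR BACKGROUND (general regularity constant `C`)**: `|(H*J)(y₀)| ≦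
C_H·10⁴d·L^{d+3}c·C·(L^{j₀}η)⁻³` for every coarse bond `y₀`, from the block-summed (3.133) `h3133` ALONE — p10's
`B9Delta2Def134.ineq3137a_of_3133_336` with `Jsup y := sup_{Δ(y)}|J|` of the pv27 current (3.11), its `h336` input discharged by
`bsupOn_J_le_of_regular` ((3.35)–(3.36), `RegularAt` at every bond, `C = O(1)Mα₀ ≦ 1`, `η ≦ L^{j}η` at every block scale) and its
`h21` input by `scaleSum_le` ((2.60)/(2.61) of [4] at the rate `½δ₁ ≧ σ + 2αδ₀`, `max(d,3)·log L ≦ αδ₀RM`).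
[cite: Balaban1985BackgroundPropagators, (3.137) p.423, (3.133) p.422, (3.35)–(3.36) p.396, (3.11) p.392; Balaban1984PropagatorsII, Lemma 2.1 (2.60)–(2.61) p.234] -/
theorem ineq3137a_of_3133_regular (hT : ∀ μ ν x, T μ (T ν x) = T ν (T μ x)) {η C : ℝ} (hη : 0 < η) (hC0 : 0 ≤ C)
    (hC1 : C ≤ 1) (hηlen : ∀ z : g.Site, η ≤ g.len z) (hreg : ∀ μ x, RegularAt T U η C (g.len (blk x)) μ x)
    (d : ℕ) (HJ : g.Site → ℝ) {CH : ℝ} (hCH : 0 ≤ CH)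
    (hd : ∀ a b : g.Site, 0 ≤ g.dist a b) (hsym : DistSymm g) {δ₀ α σ c δ₁ : ℝ}
    (h260 : Ineq260 g δ₀ α) (hαδ : 0 ≤ α * δ₀) (hrow : RowSum g σ c) (hσ : σ + 2 * (α * δ₀) ≤ δ₁ / 2)
    (hL : 1 ≤ g.L) (hge : 0 < g.eta) (hRMd : (d : ℝ) * Real.log g.L ≤ α * δ₀ * g.R * g.M)
    (hRM3 : (3 : ℝ) * Real.log g.L ≤ α * δ₀ * g.R * g.M)
    (h3133 : ∀ y₀ : g.Site, |HJ y₀| ≤ CH * ∑ y : g.Site,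
      g.len y ^ d * (g.len y₀)⁻¹ ^ d * Real.exp (-(δ₁ / 2) * g.dist y y₀) * bsupOn blk y (J T U η)) :
    ∀ y₀ : g.Site, |HJ y₀| ≤ CH * (10 ^ 4 * Fintype.card ι) * (g.L ^ (d + 3) * c) * C * (g.len y₀)⁻¹ ^ 3 := by
  have hlen : ∀ z : g.Site, 0 < g.len z := fun z => hη.trans_le (hηlen z)
  have key : Ineq3137a g HJ (CH * (10 ^ 4 * Fintype.card ι) * (g.L ^ (d + 3) * c)) C 1 :=
    ineq3137a_of_3133_336 g d HJ (fun y => bsupOn blk y (J T U η)) CH (10 ^ 4 * Fintype.card ι) (g.L ^ (d + 3) * c)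
      C 1 δ₁ hCH (by positivity) hlen h3133
      (fun y => by simpa only [mul_one] using bsupOn_J_le_of_regular T U blk hT hη hC0 hC1 hηlen hreg y)
      (fun y₀ => scaleSum_le d hd hsym h260 hαδ hrow hσ hL hge hRMd hRM3 y₀)
  intro y₀
  simpa only [mul_one] using key y₀

/-- **(3.137), FIRST BOUND, IN THE PRINTED LETTERS FOR A REGULAR BACKGROUND**: with the regularity constant written `C = Mα₀`
((3.35)–(3.36): `|A| < O(1)Mα₀(Lʲη)⁻¹`, …, the O(1) absorbed), `0 ≦ Mα₀ ≦ 1`, the conclusion is literally p10's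
`Ineq3137a g HJ (C_H·10⁴d·L^{d+3}c) M α₀`, i.e. «|(H*J)(b)| ≦ O(1)Mα₀(Lʲη)⁻³ for b ∈ Λ_j» with `O(1) = C_H·10⁴d·L^{d+3}c` — the
inputs `h336` («from the regularity condition (3.36)») and `h21` ([4] Lemma 2.1) of `B9Delta2Def134.ineq3137a_of_3133_336`
DISCHARGED, (3.133) (block-summed, `h3133`) the one remaining printed-shape hypothesis.
[cite: Balaban1985BackgroundPropagators, (3.137) p.423, (3.133) p.422, (3.35)–(3.36) p.396, (3.11) p.392; Balaban1984PropagatorsII, Lemma 2.1 (2.60)–(2.61) p.234] -/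
theorem ineq3137a_printed_of_regular (hT : ∀ μ ν x, T μ (T ν x) = T ν (T μ x)) {η M α₀ : ℝ} (hη : 0 < η)
    (hMα0 : 0 ≤ M * α₀) (hMα1 : M * α₀ ≤ 1) (hηlen : ∀ z : g.Site, η ≤ g.len z)
    (hreg : ∀ μ x, RegularAt T U η (M * α₀) (g.len (blk x)) μ x)
    (d : ℕ) (HJ : g.Site → ℝ) {CH : ℝ} (hCH : 0 ≤ CH)
    (hd : ∀ a b : g.Site, 0 ≤ g.dist a b) (hsym : DistSymm g) {δ₀ α σ c δ₁ : ℝ}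
    (h260 : Ineq260 g δ₀ α) (hαδ : 0 ≤ α * δ₀) (hrow : RowSum g σ c) (hσ : σ + 2 * (α * δ₀) ≤ δ₁ / 2)
    (hL : 1 ≤ g.L) (hge : 0 < g.eta) (hRMd : (d : ℝ) * Real.log g.L ≤ α * δ₀ * g.R * g.M)
    (hRM3 : (3 : ℝ) * Real.log g.L ≤ α * δ₀ * g.R * g.M)
    (h3133 : ∀ y₀ : g.Site, |HJ y₀| ≤ CH * ∑ y : g.Site,
      g.len y ^ d * (g.len y₀)⁻¹ ^ d * Real.exp (-(δ₁ / 2) * g.dist y y₀) * bsupOn blk y (J T U η)) :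
    Ineq3137a g HJ (CH * (10 ^ 4 * Fintype.card ι) * (g.L ^ (d + 3) * c)) M α₀ := by
  have hlen : ∀ z : g.Site, 0 < g.len z := fun z => hη.trans_le (hηlen z)
  refine ineq3137a_of_3133_336 g d HJ (fun y => bsupOn blk y (J T U η)) CH (10 ^ 4 * Fintype.card ι)
    (g.L ^ (d + 3) * c) M α₀ δ₁ hCH (by rw [mul_assoc]; exact mul_nonneg (by positivity) hMα0) hlen h3133
    (fun y => ?_) (fun y₀ => scaleSum_le d hd hsym h260 hαδ hrow hσ hL hge hRMd hRM3 y₀)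
  rw [mul_assoc (10 ^ 4 * (Fintype.card ι : ℝ))]
  exact bsupOn_J_le_of_regular T U blk hT hη hMα0 hMα1 hηlen hreg y

end Main

end Literature.MathematicalPhysics.QuantumFieldTheory.Balaban1983to89.B9Ineq3137Regular
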